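import Literature.AlgebraicGeometry.Motives.EllAdicTowerAbComparison
import Literature.AlgebraicGeometry.Motives.ConstantEtaleSheaf
import Literature.AlgebraicGeometry.Motives.EllAdicTowerRational
import Literature.AlgebraicGeometry.Motives.ZModPowTowerLim
import HarnessLib

/-!
# `H⁰` of a connected scheme in the `R`-linear `ℓ`-adic theory: `H⁰(X_ét, ℤ/ℓᵐ) = ℤ/ℓᵐ`,
# `lim_m H⁰(X_ét, ℤ/ℓᵐ) = ℤ_ℓ`, `H⁰(X_ét, ℚ_ℓ) = ℚ_ℓ`; `H⁰((X_{k̄})_ét, ℚ_ℓ) = ℚ_ℓ` for smooth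
# projective `X`

`EllAdicTowerPointZero.lean` computed the `ℓ`-adic theory of a *geometric point* in degree `0`.
This file does the same for any **connected** scheme `X` (Milne II Examples 2.18 (a): the constant
sheaf is `Y ↦ Hom(π₀(Y), M)`, so `Γ(X, M_X) = M` for `X` connected; III Example 1.7 (a); V §1:
`H⁰(X, ℤ_l) = lim H⁰(X, ℤ/lⁿ)`; Deligne, Weil I (1.3)), which is the normalisation `H⁰(X) = K` of
a Weil cohomology on geometrically connected varieties. Everything PROVED:

* `constantSheafIsoContinuousMapEtSheaf_hom_constantSection`: under the tree's
  `M_X ≅ C(–, M)` (`ConstantEtaleSheaf.lean`, `M` discrete) constant sections are constant maps;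
  hence over a connected `U` every section of `M_X` is a constant section
  (`exists_eq_constantSection_ab`, continuous maps to a discrete space are constant on a
  connected space), and likewise for the constant sheaf of `R`-modules `R_X`, `R = ULift M`
  (`exists_eq_constantSection_mod`, through `(R_X)_ab ≅ R_X` of
  `LinearCohomologyAbComparison.lean`);
* `endConstantSheafSelfValue`, `endConstantSheafSelfAddEquivOfConnected`: **`End(R_X) ≅ R` on a
  connected scheme**, by the value on the unit section — `f_X(η(1)) = η(value f)` — a ring
  isomorphism (`_id`, `_comp`: composition is multiplication of values);
* `etaleModCohomologyZeroAddEquivOfConnected : H⁰(X_ét, R) ≃+ R` (`= Ext⁰ = End`), unital and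
  **multiplicative** for the cup product (`_one`, `_cup`);
* the tower, as in `EllAdicTowerPointZero.lean`: the reductions `ρ_m` become ring homomorphisms
  `ℤ/ℓᵐ⁺¹ → ℤ/ℓᵐ`, hence the canonical ones (`RingHom.ext_zmod`;
  `levelZeroAddEquivOfConnected_zmodPowReduction`), so
  `etaleEllAdicTowerCohomologyZeroEquivOfConnected : lim_m H⁰(X_ét, ℤ/ℓᵐ) ≃ₗ[ℤ_ℓ] ℤ_ℓ`
  (`ZModPowTowerLim.lean`) and `etaleEllAdicRatZeroEquivOfConnected : H⁰(X_ét, ℚ_ℓ) ≃ₗ[ℚ_ℓ] ℚ_ℓ`,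
  both unit to unit; `finrank = 1`;
* `connectedSpace_geometricFibre`, `etaleEllAdicRatZeroEquivOfIsSmoothProjective`,
  `finrank_etaleEllAdicRat_geometricFibre_zero`: for a smooth projective (geometrically
  irreducible) `k`-variety `X`, `X_{k̄}` is connected and **`H⁰((X_{k̄})_ét, ℚ_ℓ) ≃ₗ[ℚ_ℓ] ℚ_ℓ`**
  — the value of `ellAdicCohomologyFunctor k ℓ 0` (`EllAdicCohomologyFunctorOver.lean`) — on
  which the Galois group acts trivially (`geometricEllAdicRatRep_zero_apply`).

## References

* J. S. Milne, *Étale cohomology*, Princeton (reissue 2025; held copy, PDF pages): II Examples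
  2.18 (a) (p. 73), III Example 1.7 (a) (p. 95), V §1 (p. 176). [Milne2025]
* P. Deligne, *La conjecture de Weil. I*, Publ. Math. IHÉS 43 (1974), (1.3) (p. 274). [Deligne1974]

## Design notes

* Coefficients are `R = ULift.{u} M` with `M : Type` a commutative ring (the shape of
  `ZModPow ℓ m = ULift (ZMod (ℓ ^ m))` and of `ConstantEtaleSheaf.lean`, whose `M_X ≅ C(–, M)`
  takes `M : Type`); the discrete topology on `M` is introduced inside the proofs only.
* Mathlib searches: no description of global sections of a constant sheaf on a connected site /
  scheme (`Sheaf.isConstant`, `IsLocalSite` only); the tree's `ConstantEtaleSheaf.lean` is used.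
-/

open CategoryTheory CategoryTheory.Limits CategoryTheory.Abelian Opposite
open scoped TensorProduct

universe u

noncomputable section

namespace Literature.AlgebraicGeometry.Motives

open _root_.AlgebraicGeometry

/-! ### Constant sections of the constant abelian étale sheaf are constant maps -/

section AbSections

variable (X : Scheme.{u}) (M : Type) [AddCommGroup M] [TopologicalSpace M] [DiscreteTopology M]

set_option backward.isDefEq.respectTransparency false in
/-- Under `M_X ≅ C(–, M)` (`constantSheafIsoContinuousMapEtSheaf`, Milne II 2.18 (a)), the
constant section of `m` over `U` is the constant map with value `m` (the comparison is the
sheafification of "`m ↦` constant map `m`"). [cite: Milne2025, II Examples 2.18 (a)] -/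
theorem constantSheafIsoContinuousMapEtSheaf_hom_constantSection (U : X.Etale) (m : ULift.{u} M) :
    ((constantSheafIsoContinuousMapEtSheaf X M).hom.hom.app (op U)
        (constantSection X.smallEtaleTopology (AddCommGrpCat.of (ULift.{u} M)) U m) :
          C(U.left, M)) = ContinuousMap.const _ m.down := by
  have key : toSheafify X.smallEtaleTopology
        ((Functor.const (X.Etale)ᵒᵖ).obj (AddCommGrpCat.of (ULift.{u} M))) ≫
      (constantSheafIsoContinuousMapEtSheaf X M).hom.hom = constToContinuousMapEtSheaf X M := by
    change toSheafify X.smallEtaleTopology _ ≫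
      sheafifyMap X.smallEtaleTopology (constToContinuousMapEtSheaf X M) ≫
        (isoSheafify X.smallEtaleTopology (continuousMapEtSheaf X M).2).inv = _
    rw [← Category.assoc, ← toSheafify_naturality, Category.assoc,
      ← isoSheafify_hom X.smallEtaleTopology (continuousMapEtSheaf X M).2, Iso.hom_inv_id,
      Category.comp_id]
  have h := congrArg (fun α => (ConcreteCategory.hom (NatTrans.app α (op U))) m) key
  exact h

/-- Constant sections with different values differ over a non-empty `U`. [folklore] -/
theorem constantSection_ab_injective (U : X.Etale) [Nonempty U.left] :
    Function.Injective
      (constantSection X.smallEtaleTopology (AddCommGrpCat.of (ULift.{u} M)) U) := by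
  intro m m' h
  have h' : ((constantSheafIsoContinuousMapEtSheaf X M).hom.hom.app (op U)
      (constantSection X.smallEtaleTopology (AddCommGrpCat.of (ULift.{u} M)) U m) : C(U.left, M)) =
      (constantSheafIsoContinuousMapEtSheaf X M).hom.hom.app (op U)
        (constantSection X.smallEtaleTopology (AddCommGrpCat.of (ULift.{u} M)) U m') :=
    congrArg _ h
  rw [constantSheafIsoContinuousMapEtSheaf_hom_constantSection,
    constantSheafIsoContinuousMapEtSheaf_hom_constantSection] at h'
  have h'' := congrArg (fun φ : C(U.left, M) => φ (Classical.arbitrary U.left)) h'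
  exact ULift.ext _ _ h''

/-- **Over a connected `U`, every section of the constant sheaf `M_X` is a constant section**
(sections are continuous maps to the discrete `M`, constant on a connected space).
[cite: Milne2025, II Examples 2.18 (a)] -/
theorem exists_eq_constantSection_ab (U : X.Etale) [ConnectedSpace U.left]
    (s : ((constantSheaf X.smallEtaleTopology Ab.{u}).obj (AddCommGrpCat.of (ULift.{u} M))).obj.obj
      (op U)) :
    ∃ m : ULift.{u} M, s = constantSection X.smallEtaleTopology (AddCommGrpCat.of (ULift.{u} M)) U m := by
  let e := constantSheafIsoContinuousMapEtSheaf X M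
  let φ : C(U.left, M) := e.hom.hom.app (op U) s
  refine ⟨ULift.up (φ (Classical.arbitrary U.left)), ?_⟩
  have hinj : Function.Injective (e.hom.hom.app (op U)) := by
    intro a b hab
    have := congrArg (e.inv.hom.app (op U)) hab
    have hid : ∀ c, e.inv.hom.app (op U) (e.hom.hom.app (op U) c) = c := fun c => by
      change ((e.hom ≫ e.inv).hom.app (op U)) c = c
      rw [Iso.hom_inv_id]
      rfl
    rwa [hid, hid] at this
  apply hinj
  change φ = ((constantSheafIsoContinuousMapEtSheaf X M).hom.hom.app (op U) _ : C(U.left, M))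
  rw [constantSheafIsoContinuousMapEtSheaf_hom_constantSection]
  ext x
  exact PreconnectedSpace.constant inferInstance φ.continuous

end AbSections

/-! ### Sections of the constant sheaf of `R`-modules `R_X` over a connected scheme -/

section ModSections

variable (X : Scheme.{u}) (M : Type) [CommRing M]

/-- **Over a connected `U`, every section of `R_X ∈ S(X_ét, (ULift.{u} M))` is a constant section** (through
`(R_X)_ab ≅ R_X`, `toAbSheafConstantSheafIso`, which preserves constant sections).
[cite: Milne2025, II Examples 2.18 (a)] -/
theorem exists_eq_constantSection_mod (U : X.Etale) [ConnectedSpace U.left]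
    (s : (constantSheafSelf X.smallEtaleTopology (ULift.{u} M)).obj.obj (op U)) :
    ∃ r : (ULift.{u} M), s = constantSection X.smallEtaleTopology (ModuleCat.of (ULift.{u} M) (ULift.{u} M)) U r := by
  letI : TopologicalSpace M := ⊥
  haveI : DiscreteTopology M := ⟨rfl⟩
  obtain ⟨m, hm⟩ := exists_eq_constantSection_ab X M U
    ((toAbSheafConstantSheafIso X.smallEtaleTopology (ULift.{u} M)).hom.hom.app (op U) s)
  refine ⟨m, ?_⟩
  have h := congrArg ((toAbSheafConstantSheafIso X.smallEtaleTopology (ULift.{u} M)).inv.hom.app (op U)) hm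
  rw [constantSection_toAbSheafConstantSheafIso_inv] at h
  refine Eq.trans ?_ h
  change s = ((toAbSheafConstantSheafIso X.smallEtaleTopology (ULift.{u} M)).hom ≫
    (toAbSheafConstantSheafIso X.smallEtaleTopology (ULift.{u} M)).inv).hom.app (op U) s
  rw [Iso.hom_inv_id]
  rfl

/-- Constant sections of `R_X` with different values differ over a non-empty `U`. [folklore] -/
theorem constantSection_mod_injective (U : X.Etale) [Nonempty U.left] :
    Function.Injective (constantSection X.smallEtaleTopology (ModuleCat.of (ULift.{u} M) (ULift.{u} M)) U) := by
  letI : TopologicalSpace M := ⊥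
  haveI : DiscreteTopology M := ⟨rfl⟩
  intro r r' h
  have h' := congrArg ((toAbSheafConstantSheafIso X.smallEtaleTopology (ULift.{u} M)).hom.hom.app (op U)) h
  rw [constantSection_toAbSheafConstantSheafIso_hom, constantSection_toAbSheafConstantSheafIso_hom]
    at h'
  exact constantSection_ab_injective X M U h'

variable [ConnectedSpace X]

/-- The final object `X → X` of `X_et` has connected source when `X` is connected (its source is
`X`; recorded for instance search). [folklore] -/
instance connectedSpace_etaleMkId_left : ConnectedSpace (Scheme.Etale.mk (𝟙 X)).left :=
  ‹ConnectedSpace X›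

/-- The final object of `X_et` has non-empty source when `X` is connected. [folklore] -/
instance nonempty_etaleMkId_left : Nonempty (Scheme.Etale.mk (𝟙 X)).left :=
  (inferInstance : Nonempty X)

/-- **The value of an endomorphism of `R_X` on a connected scheme**: the unique `r ∈ (ULift.{u} M)` with
`f_X(η(1)) = η(r)` (`η` the constant section over `X`). [folklore] -/
def endConstantSheafSelfValue
    (f : constantSheafSelf X.smallEtaleTopology (ULift.{u} M) ⟶ constantSheafSelf X.smallEtaleTopology (ULift.{u} M)) : (ULift.{u} M) :=
  (exists_eq_constantSection_mod X M (Scheme.Etale.mk (𝟙 X))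
    (f.hom.app (op (Scheme.Etale.mk (𝟙 X)))
      (constantSection X.smallEtaleTopology (ModuleCat.of (ULift.{u} M) (ULift.{u} M)) (Scheme.Etale.mk (𝟙 X)) 1))).choose

/-- The defining property `f_X(η(1)) = η(value f)`. [folklore] -/
theorem endConstantSheafSelfValue_spec
    (f : constantSheafSelf X.smallEtaleTopology (ULift.{u} M) ⟶ constantSheafSelf X.smallEtaleTopology (ULift.{u} M)) :
    f.hom.app (op (Scheme.Etale.mk (𝟙 X)))
        (constantSection X.smallEtaleTopology (ModuleCat.of (ULift.{u} M) (ULift.{u} M)) (Scheme.Etale.mk (𝟙 X)) 1) =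
      constantSection X.smallEtaleTopology (ModuleCat.of (ULift.{u} M) (ULift.{u} M)) (Scheme.Etale.mk (𝟙 X))
        (endConstantSheafSelfValue X M f) :=
  (exists_eq_constantSection_mod X M (Scheme.Etale.mk (𝟙 X)) _).choose_spec

/-- `f_X(η(r)) = η(r · value f)` for every `r` (`(ULift.{u} M)`-linearity). [folklore] -/
theorem endConstantSheafSelf_app_constantSection
    (f : constantSheafSelf X.smallEtaleTopology (ULift.{u} M) ⟶ constantSheafSelf X.smallEtaleTopology (ULift.{u} M)) (r : (ULift.{u} M)) :
    f.hom.app (op (Scheme.Etale.mk (𝟙 X)))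
        (constantSection X.smallEtaleTopology (ModuleCat.of (ULift.{u} M) (ULift.{u} M)) (Scheme.Etale.mk (𝟙 X)) r) =
      constantSection X.smallEtaleTopology (ModuleCat.of (ULift.{u} M) (ULift.{u} M)) (Scheme.Etale.mk (𝟙 X))
        (r * endConstantSheafSelfValue X M f) := by
  have hr : constantSection X.smallEtaleTopology (ModuleCat.of (ULift.{u} M) (ULift.{u} M)) (Scheme.Etale.mk (𝟙 X)) r =
      r • constantSection X.smallEtaleTopology (ModuleCat.of (ULift.{u} M) (ULift.{u} M)) (Scheme.Etale.mk (𝟙 X)) 1 := by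
    rw [← map_smul, smul_eq_mul, mul_one]
  rw [hr, map_smul, endConstantSheafSelfValue_spec, ← map_smul, smul_eq_mul]

/-- The value is characterised by the defining property. [folklore] -/
theorem endConstantSheafSelfValue_eq_of_eq
    (f : constantSheafSelf X.smallEtaleTopology (ULift.{u} M) ⟶ constantSheafSelf X.smallEtaleTopology (ULift.{u} M)) (r : (ULift.{u} M))
    (h : f.hom.app (op (Scheme.Etale.mk (𝟙 X)))
        (constantSection X.smallEtaleTopology (ModuleCat.of (ULift.{u} M) (ULift.{u} M)) (Scheme.Etale.mk (𝟙 X)) 1) =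
      constantSection X.smallEtaleTopology (ModuleCat.of (ULift.{u} M) (ULift.{u} M)) (Scheme.Etale.mk (𝟙 X)) r) :
    endConstantSheafSelfValue X M f = r :=
  constantSection_mod_injective X M (Scheme.Etale.mk (𝟙 X))
    ((endConstantSheafSelfValue_spec X M f).symm.trans h)

/-- `value 𝟙 = 1`. [folklore] -/
theorem endConstantSheafSelfValue_id :
    endConstantSheafSelfValue X M (𝟙 (constantSheafSelf X.smallEtaleTopology (ULift.{u} M))) = 1 :=
  endConstantSheafSelfValue_eq_of_eq X M _ _ rfl

/-- **`value (f ≫ g) = value f · value g`** (composition of endomorphisms is multiplication of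
values). [folklore] -/
theorem endConstantSheafSelfValue_comp
    (f g : constantSheafSelf X.smallEtaleTopology (ULift.{u} M) ⟶ constantSheafSelf X.smallEtaleTopology (ULift.{u} M)) :
    endConstantSheafSelfValue X M (f ≫ g) =
      endConstantSheafSelfValue X M f * endConstantSheafSelfValue X M g := by
  apply endConstantSheafSelfValue_eq_of_eq
  change g.hom.app _ (f.hom.app _ _) = _
  rw [endConstantSheafSelfValue_spec, endConstantSheafSelf_app_constantSection]

/-- `value (f + g) = value f + value g`. [folklore] -/
theorem endConstantSheafSelfValue_add
    (f g : constantSheafSelf X.smallEtaleTopology (ULift.{u} M) ⟶ constantSheafSelf X.smallEtaleTopology (ULift.{u} M)) :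
    endConstantSheafSelfValue X M (f + g) =
      endConstantSheafSelfValue X M f + endConstantSheafSelfValue X M g := by
  apply endConstantSheafSelfValue_eq_of_eq
  change f.hom.app _ _ + g.hom.app _ _ = _
  rw [endConstantSheafSelfValue_spec, endConstantSheafSelfValue_spec, map_add]

/-- `value (r • 𝟙) = r`: every `r` is a value. [folklore] -/
theorem endConstantSheafSelfValue_smul_id (r : (ULift.{u} M)) :
    endConstantSheafSelfValue X M (r • 𝟙 (constantSheafSelf X.smallEtaleTopology (ULift.{u} M))) = r := by
  apply endConstantSheafSelfValue_eq_of_eq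
  change r • constantSection X.smallEtaleTopology (ModuleCat.of (ULift.{u} M) (ULift.{u} M)) (Scheme.Etale.mk (𝟙 X)) 1 = _
  rw [← map_smul, smul_eq_mul, mul_one]

/-- An endomorphism of `R_X` with value `0` is `0` (maps out of a constant sheaf are determined by
the image of the unit section). [folklore] -/
theorem eq_zero_of_endConstantSheafSelfValue_eq_zero
    (f : constantSheafSelf X.smallEtaleTopology (ULift.{u} M) ⟶ constantSheafSelf X.smallEtaleTopology (ULift.{u} M))
    (hf : endConstantSheafSelfValue X M f = 0) : f = 0 := by
  apply constantSheaf_hom_ext (isTerminalEtaleMkId X)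
  ext : 1
  apply LinearMap.ext_ring
  change f.hom.app _ (constantSection X.smallEtaleTopology (ModuleCat.of (ULift.{u} M) (ULift.{u} M)) _ (1 : (ULift.{u} M))) =
    (0 : constantSheafSelf X.smallEtaleTopology (ULift.{u} M) ⟶ _).hom.app _
      (constantSection X.smallEtaleTopology (ModuleCat.of (ULift.{u} M) (ULift.{u} M)) _ (1 : (ULift.{u} M)))
  rw [endConstantSheafSelfValue_spec, hf, map_zero]
  rfl

/-- **`End(R_X) ≃+ (ULift.{u} M)` on a connected scheme** by the value on the unit section (a ring
isomorphism: `endConstantSheafSelfValue_id/_comp`). [folklore] -/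
def endConstantSheafSelfAddEquivOfConnected :
    (constantSheafSelf X.smallEtaleTopology (ULift.{u} M) ⟶ constantSheafSelf X.smallEtaleTopology (ULift.{u} M)) ≃+ (ULift.{u} M) :=
  AddEquiv.ofBijective
    ({ toFun := endConstantSheafSelfValue X M
       map_zero' := by
         have h := endConstantSheafSelfValue_smul_id X M 0
         rwa [zero_smul] at h
       map_add' := endConstantSheafSelfValue_add X M } :
      (constantSheafSelf X.smallEtaleTopology (ULift.{u} M) ⟶
        constantSheafSelf X.smallEtaleTopology (ULift.{u} M)) →+ ULift.{u} M)
    ⟨fun f g h => by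
      rw [← sub_eq_zero]
      apply eq_zero_of_endConstantSheafSelfValue_eq_zero
      have hsub : endConstantSheafSelfValue X M (f - g) + endConstantSheafSelfValue X M g =
          endConstantSheafSelfValue X M f := by
        rw [← endConstantSheafSelfValue_add, sub_add_cancel]
      change endConstantSheafSelfValue X M f = endConstantSheafSelfValue X M g at h
      rw [h] at hsub
      exact add_eq_right.1 hsub,
     fun r => ⟨r • 𝟙 _, endConstantSheafSelfValue_smul_id X M r⟩⟩

end ModSections

/-! ### `H⁰(X_ét, R) = R` for connected `X`, multiplicatively -/

section ZeroConnected

variable (X : Scheme.{u}) [ConnectedSpace X] (M : Type) [CommRing M]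

/-- **`H⁰(X_ét, R) ≃+ R` for a connected scheme `X`** (`R = ULift M`, e.g. `ℤ/ℓᵐ`):
`H⁰ = Ext⁰(R_X, R_X) = End(R_X)` (Mathlib `Ext.addEquiv₀`) and `End(R_X) = R` by the value on
the unit section (`endConstantSheafSelfAddEquivOfConnected`). Milne III Example 1.7 (a) / V §1:
`H⁰(X, ℤ/ℓⁿ) = ℤ/ℓⁿ` for `X` connected. [cite: Milne2025, II Examples 2.18 (a)] -/
def etaleModCohomologyZeroAddEquivOfConnected :
    etaleModCohomology X (ULift.{u} M) 0 ≃+ ULift.{u} M :=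
  Ext.addEquiv₀.trans (endConstantSheafSelfAddEquivOfConnected X M)

/-- The identification on the class of an endomorphism is its value. [folklore] -/
theorem etaleModCohomologyZeroAddEquivOfConnected_mk₀
    (φ : constantSheafSelf X.smallEtaleTopology (ULift.{u} M) ⟶
      constantSheafSelf X.smallEtaleTopology (ULift.{u} M)) :
    etaleModCohomologyZeroAddEquivOfConnected X M (Ext.mk₀ φ) = endConstantSheafSelfValue X M φ := by
  have h0 : Ext.addEquiv₀ (Ext.mk₀ φ) = φ :=
    (Ext.mk₀_bijective _ _).1 (by rw [Ext.mk₀_addEquiv₀_apply])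
  change endConstantSheafSelfValue X M (Ext.addEquiv₀ (Ext.mk₀ φ)) = _
  rw [h0]

/-- **`1 ↦ 1`.** [folklore] -/
theorem etaleModCohomologyZeroAddEquivOfConnected_one :
    etaleModCohomologyZeroAddEquivOfConnected X M
        (linearCohomology.one X.smallEtaleTopology (ULift.{u} M)) = 1 := by
  rw [linearCohomology.one, etaleModCohomologyZeroAddEquivOfConnected_mk₀,
    endConstantSheafSelfValue_id]

/-- **The identification is multiplicative**: `e(x ∪ y) = e(x) e(y)` (in degree `0` the cup
product is composition of endomorphisms of `R_X`, whose values multiply). [folklore] -/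
theorem etaleModCohomologyZeroAddEquivOfConnected_cup
    (x y : etaleModCohomology X (ULift.{u} M) 0) :
    etaleModCohomologyZeroAddEquivOfConnected X M (linearCohomology.cup (add_zero 0) x y) =
      etaleModCohomologyZeroAddEquivOfConnected X M x *
        etaleModCohomologyZeroAddEquivOfConnected X M y := by
  obtain ⟨f, rfl⟩ := (Ext.mk₀_bijective _ _).2 x
  obtain ⟨g, rfl⟩ := (Ext.mk₀_bijective _ _).2 y
  rw [linearCohomology.cup_apply, Ext.mk₀_comp_mk₀, etaleModCohomologyZeroAddEquivOfConnected_mk₀,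
    etaleModCohomologyZeroAddEquivOfConnected_mk₀, etaleModCohomologyZeroAddEquivOfConnected_mk₀,
    endConstantSheafSelfValue_comp]

end ZeroConnected

/-! ### The `ℓ`-adic tower in degree `0` on a connected scheme -/

section Level

variable (X : Scheme.{u}) [ConnectedSpace X] (ℓ : ℕ) [Fact ℓ.Prime]

/-- The isomorphism `H⁰(X_ét, ℤ/ℓᵐ) ≃ ℤ/ℓᵐ` at level `m` of the tower (`X` connected). [folklore] -/
abbrev levelZeroAddEquivOfConnected (m : ℕ) :
    etaleZModPowCohomology X ℓ m 0 ≃+ ZModPow.{u} ℓ m :=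
  etaleModCohomologyZeroAddEquivOfConnected X (ZMod (ℓ ^ m))

/-- The reduction `ρ_m` of the tower, transported to `ℤ/ℓᵐ⁺¹ → ℤ/ℓᵐ`: a ring homomorphism (`ρ_m`
is multiplicative and unital, `zmodPowReduction_cup/_one`, and the identifications are
multiplicative and unital). [folklore] -/
def levelReductionHomOfConnected (m : ℕ) : ZModPow.{u} ℓ (m + 1) →+* ZModPow.{u} ℓ m where
  toFun s := levelZeroAddEquivOfConnected X ℓ m
    (zmodPowReduction (isTerminalEtaleMkId X) ℓ m 0 ((levelZeroAddEquivOfConnected X ℓ (m + 1)).symm s))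
  map_one' := by
    have h1 : (levelZeroAddEquivOfConnected X ℓ (m + 1)).symm 1 =
        linearCohomology.one X.smallEtaleTopology (ZModPow.{u} ℓ (m + 1)) :=
      (AddEquiv.symm_apply_eq _).2
        (etaleModCohomologyZeroAddEquivOfConnected_one X (ZMod (ℓ ^ (m + 1)))).symm
    rw [h1, zmodPowReduction_one]
    exact etaleModCohomologyZeroAddEquivOfConnected_one X (ZMod (ℓ ^ m))
  map_mul' s t := by
    have hs : ∀ s t : ZModPow.{u} ℓ (m + 1), (levelZeroAddEquivOfConnected X ℓ (m + 1)).symm (s * t) =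
        linearCohomology.cup (add_zero 0) ((levelZeroAddEquivOfConnected X ℓ (m + 1)).symm s)
          ((levelZeroAddEquivOfConnected X ℓ (m + 1)).symm t) := fun s t =>
      (AddEquiv.symm_apply_eq _).2 (by
        rw [etaleModCohomologyZeroAddEquivOfConnected_cup, AddEquiv.apply_symm_apply,
          AddEquiv.apply_symm_apply])
    change levelZeroAddEquivOfConnected X ℓ m (zmodPowReduction _ ℓ m 0 _) = _
    rw [hs, zmodPowReduction_cup]
    exact etaleModCohomologyZeroAddEquivOfConnected_cup X (ZMod (ℓ ^ m)) _ _
  map_zero' := by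
    rw [map_zero, map_zero, map_zero]
  map_add' s t := by
    rw [map_add, map_add, map_add]

/-- **There is only one ring homomorphism `ℤ/ℓᵐ⁺¹ → ℤ/ℓᵐ`**, so the transported reduction is the
canonical one (Mathlib `RingHom.ext_zmod`). [folklore] -/
theorem levelReductionHomOfConnected_eq (m : ℕ) :
    levelReductionHomOfConnected X ℓ m = zmodPowRed.{u} ℓ m := by
  have h : (levelReductionHomOfConnected X ℓ m).comp ULift.ringEquiv.{0, u}.symm.toRingHom =
      (zmodPowRed.{u} ℓ m).comp ULift.ringEquiv.{0, u}.symm.toRingHom :=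
    RingHom.ext_zmod _ _
  refine RingHom.ext fun s => ?_
  have hs : ULift.ringEquiv.{0, u}.symm s.down = s := rfl
  rw [← hs]
  exact RingHom.congr_fun h s.down

/-- **The reductions of the `ℓ`-adic tower in degree `0` are the reductions `ℤ/ℓᵐ⁺¹ → ℤ/ℓᵐ`**
under `H⁰(X_ét, ℤ/ℓ•) ≃ ℤ/ℓ•` (`X` connected). [folklore] -/
theorem levelZeroAddEquivOfConnected_zmodPowReduction (m : ℕ)
    (x : etaleZModPowCohomology X ℓ (m + 1) 0) :
    levelZeroAddEquivOfConnected X ℓ m (zmodPowReduction (isTerminalEtaleMkId X) ℓ m 0 x) =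
      zmodPowRed.{u} ℓ m (levelZeroAddEquivOfConnected X ℓ (m + 1) x) := by
  have h := RingHom.congr_fun (levelReductionHomOfConnected_eq X ℓ m)
    (levelZeroAddEquivOfConnected X ℓ (m + 1) x)
  rw [← h]
  change _ = levelZeroAddEquivOfConnected X ℓ m (zmodPowReduction _ ℓ m 0
    ((levelZeroAddEquivOfConnected X ℓ (m + 1)).symm (levelZeroAddEquivOfConnected X ℓ (m + 1) x)))
  rw [AddEquiv.symm_apply_apply]

end Level

section Tower

variable (X : Scheme.{u}) [ConnectedSpace X] (ℓ : ℕ) [Fact ℓ.Prime]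

/-- **`lim_m H⁰(X_ét, ℤ/ℓᵐ) ≃ lim_m ℤ/ℓᵐ`**, `ℤ_ℓ`-linear, for `X` connected. [folklore] -/
def etaleEllAdicTowerCohomologyZeroEquivTowerLimOfConnected :
    etaleEllAdicTowerCohomology X ℓ 0 ≃ₗ[ℤ_[ℓ]] towerLim (zmodPowTower.{u} ℓ) :=
  { towerLim.congrAddEquiv (fun m => levelZeroAddEquivOfConnected X ℓ m)
      (fun m x => levelZeroAddEquivOfConnected_zmodPowReduction X ℓ m x) with
    map_smul' := fun c x => Subtype.ext <| funext fun m => by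
      change levelZeroAddEquivOfConnected X ℓ m (((c • x : etaleEllAdicTowerCohomology X ℓ 0) :
          ∀ m, etaleZModPowCohomology X ℓ m 0) m) =
        ((c • towerLim.congrAddEquiv (fun m => levelZeroAddEquivOfConnected X ℓ m)
          (fun m x => levelZeroAddEquivOfConnected_zmodPowReduction X ℓ m x) x :
            towerLim (zmodPowTower.{u} ℓ)) : ∀ m, ZModPow.{u} ℓ m) m
      rw [towerLim.coe_smul_apply, towerLim.coe_smul_apply, map_nsmul]
      rfl }

/-- Components: `(e x)_m = e_m(x_m)`. [folklore] -/
theorem coe_etaleEllAdicTowerCohomologyZeroEquivTowerLimOfConnected_apply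
    (x : etaleEllAdicTowerCohomology X ℓ 0) (m : ℕ) :
    (etaleEllAdicTowerCohomologyZeroEquivTowerLimOfConnected X ℓ x : ∀ m, ZModPow.{u} ℓ m) m =
      levelZeroAddEquivOfConnected X ℓ m ((x : ∀ m, etaleZModPowCohomology X ℓ m 0) m) :=
  rfl

/-- **`lim_m H⁰(X_ét, ℤ/ℓᵐ) ≃ ℤ_ℓ` as `ℤ_ℓ`-modules for `X` connected**: `= lim ℤ/ℓᵐ = ℤ_ℓ`
(Milne V §1: `H⁰(X, ℤ_l) = lim H⁰(X, ℤ/lⁿ)`). [cite: Milne2025, V §1 (p. 176)] -/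
def etaleEllAdicTowerCohomologyZeroEquivOfConnected :
    etaleEllAdicTowerCohomology X ℓ 0 ≃ₗ[ℤ_[ℓ]] ℤ_[ℓ] :=
  (etaleEllAdicTowerCohomologyZeroEquivTowerLimOfConnected X ℓ).trans
    (padicIntEquivZModPowTowerLim.{u} ℓ).symm

/-- The unit `1 ∈ lim_m H⁰(X_ét, ℤ/ℓᵐ)` goes to `1 ∈ ℤ_ℓ`. [folklore] -/
theorem etaleEllAdicTowerCohomologyZeroEquivOfConnected_one :
    etaleEllAdicTowerCohomologyZeroEquivOfConnected X ℓ
        (ellAdicTowerCohomology.one (isTerminalEtaleMkId X) ℓ) = 1 := by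
  change (padicIntEquivZModPowTowerLim.{u} ℓ).symm
    (etaleEllAdicTowerCohomologyZeroEquivTowerLimOfConnected X ℓ
      (ellAdicTowerCohomology.one (isTerminalEtaleMkId X) ℓ)) = 1
  rw [LinearEquiv.symm_apply_eq]
  refine Subtype.ext (funext fun m => ?_)
  rw [coe_etaleEllAdicTowerCohomologyZeroEquivTowerLimOfConnected_apply,
    ellAdicTowerCohomology.coe_one, coe_padicIntEquivZModPowTowerLim_one]
  exact etaleModCohomologyZeroAddEquivOfConnected_one X (ZMod (ℓ ^ m))

end Tower

section Rat

variable (X : Scheme.{u}) [ConnectedSpace X] (ℓ : ℕ) [Fact ℓ.Prime]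

/-- **`H⁰(X_ét, ℚ_ℓ) ≃ ℚ_ℓ` for `X` connected**: `ℚ_ℓ ⊗_{ℤ_ℓ} lim_m H⁰(ℤ/ℓᵐ) ≃ ℚ_ℓ ⊗ ℤ_ℓ ≃ ℚ_ℓ`
(Deligne, Weil I (1.3); Milne V §1). [cite: Milne2025, V §1 (p. 176)] -/
def etaleEllAdicRatZeroEquivOfConnected : etaleEllAdicRat ℓ X 0 ≃ₗ[ℚ_[ℓ]] ℚ_[ℓ] :=
  ((etaleEllAdicTowerCohomologyZeroEquivOfConnected X ℓ).baseChange ℤ_[ℓ] ℚ_[ℓ] _ _).trans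
    (TensorProduct.AlgebraTensorModule.rid ℤ_[ℓ] ℚ_[ℓ] ℚ_[ℓ])

/-- The unit `1 ∈ H⁰(X_ét, ℚ_ℓ)` goes to `1 ∈ ℚ_ℓ`. [folklore] -/
theorem etaleEllAdicRatZeroEquivOfConnected_one :
    etaleEllAdicRatZeroEquivOfConnected X ℓ (etaleEllAdicRat.one ℓ X) = 1 := by
  change TensorProduct.AlgebraTensorModule.rid ℤ_[ℓ] ℚ_[ℓ] ℚ_[ℓ]
    (((etaleEllAdicTowerCohomologyZeroEquivOfConnected X ℓ).baseChange ℤ_[ℓ] ℚ_[ℓ] _ _)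
      ((1 : ℚ_[ℓ]) ⊗ₜ ellAdicTowerCohomology.one (isTerminalEtaleMkId X) ℓ)) = 1
  rw [LinearEquiv.baseChange_tmul, etaleEllAdicTowerCohomologyZeroEquivOfConnected_one,
    TensorProduct.AlgebraTensorModule.rid_tmul, one_smul]

/-- `H⁰(X_ét, ℚ_ℓ)` is one-dimensional for `X` connected. [folklore] -/
theorem finrank_etaleEllAdicRat_zero_of_connected : Module.finrank ℚ_[ℓ] (etaleEllAdicRat ℓ X 0) = 1 := by
  rw [(etaleEllAdicRatZeroEquivOfConnected X ℓ).finrank_eq, Module.finrank_self]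

end Rat

/-! ### `H⁰((X_{k̄})_ét, ℚ_ℓ) = ℚ_ℓ` for geometrically irreducible `X` (the Weil functor) -/

section Weil

variable {k : Type u} [Field k] (ℓ : ℕ) [Fact ℓ.Prime]

/-- The geometric fibre of a smooth projective (geometrically irreducible) `k`-variety is
connected. [folklore] -/
theorem connectedSpace_geometricFibre {n : ℕ} {X : SchemeOver k} (hX : IsSmoothProjective n X) :
    ConnectedSpace (geometricFibre k X) := by
  have hY : IsSmoothProjective n ((baseChange k (AlgebraicClosure k)).obj X) :=
    hX.baseChange_obj (AlgebraicClosure k)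
  haveI := hY.geometricallyIrreducible
  haveI : IrreducibleSpace ((baseChange k (AlgebraicClosure k)).obj X).left :=
    GeometricallyIrreducible.irreducibleSpace_of_subsingleton
      ((baseChange k (AlgebraicClosure k)).obj X).hom
  change ConnectedSpace ((baseChange k (AlgebraicClosure k)).obj X).left
  infer_instance

/-- **`H⁰((X_{k̄})_ét, ℚ_ℓ) ≃ ℚ_ℓ` for a smooth projective variety `X`** (value of
`ellAdicCohomologyFunctor k ℓ 0`, `EllAdicCohomologyFunctorOver.lean`-shape): the normalisation
`H⁰(X) = K` of a Weil cohomology on geometrically connected varieties.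
[cite: Deligne1974, (1.3) (p. 274)] -/
def etaleEllAdicRatZeroEquivOfIsSmoothProjective {n : ℕ} {X : SchemeOver k}
    (hX : IsSmoothProjective n X) : etaleEllAdicRat ℓ (geometricFibre k X) 0 ≃ₗ[ℚ_[ℓ]] ℚ_[ℓ] :=
  haveI := connectedSpace_geometricFibre hX
  etaleEllAdicRatZeroEquivOfConnected (geometricFibre k X) ℓ

/-- `dim H⁰((X_{k̄})_ét, ℚ_ℓ) = 1` for a smooth projective variety `X`. [folklore] -/
theorem finrank_etaleEllAdicRat_geometricFibre_zero {n : ℕ} {X : SchemeOver k}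
    (hX : IsSmoothProjective n X) :
    Module.finrank ℚ_[ℓ] (etaleEllAdicRat ℓ (geometricFibre k X) 0) = 1 :=
  haveI := connectedSpace_geometricFibre hX
  finrank_etaleEllAdicRat_zero_of_connected (geometricFibre k X) ℓ

/-- Every class in `H⁰(X_ét, ℚ_ℓ)` of a connected `X` is a scalar multiple of `1`. [folklore] -/
theorem eq_smul_one_of_connected (X : Scheme.{u}) [ConnectedSpace X] (x : etaleEllAdicRat ℓ X 0) :
    x = etaleEllAdicRatZeroEquivOfConnected X ℓ x • etaleEllAdicRat.one ℓ X := by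
  apply (etaleEllAdicRatZeroEquivOfConnected X ℓ).injective
  rw [LinearEquiv.map_smul, etaleEllAdicRatZeroEquivOfConnected_one, smul_eq_mul, mul_one]

/-- **The Galois group acts trivially on `H⁰((X_{k̄})_ét, ℚ_ℓ)`** for a smooth projective variety
`X` (`H⁰ = ℚ_ℓ · 1` and `ρ(g)(1) = 1`). [folklore] -/
theorem geometricEllAdicRatRep_zero_apply {n : ℕ} {X : SchemeOver k} (hX : IsSmoothProjective n X)
    (g : Field.absoluteGaloisGroup k) (x : etaleEllAdicRat ℓ (geometricFibre k X) 0) :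
    geometricEllAdicRatRep X ℓ 0 g x = x := by
  haveI := connectedSpace_geometricFibre hX
  rw [eq_smul_one_of_connected ℓ (geometricFibre k X) x, LinearMap.map_smul, geometricEllAdicRatRep_one]

end Weil

end Literature.AlgebraicGeometry.Motives

end
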